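import Summits.HodgeConjecture.HodgeCM.PerL34.PrintedTorusEndState_1

/-! PORT of `HodgeCM/PerL34/PrintedTorusEndState.lean` (HodgeCMPerL run 82) — part 2: continuation of `Summits.HodgeConjecture.HodgeCM.PerL34.PrintedTorusEndState_1` (split at a top-level declaration boundary by port_pkg.py; scope re-opened below; declarations unchanged). -/

-- port_pkg: scope re-opened for this part (file-level context, then the namespace/section stack open at the cut)
set_option autoImplicit false
noncomputable section
open scoped InnerProductSpace
namespace HodgeCM
namespace Universe
namespace AdelicTorusCore
open HodgeCM.PerL34 HodgeCM.PerL34.ArchC HodgeCM.PerL34.Fock HodgeCM.PerL34.Fock.PrintDict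
open HodgeCM.Prior.Perl34File HodgeCM.Prior.Perl34File.Perl34
open NumberField NumberField.SeesawArchTorus
variable {U : Universe} {hP : PrintFact_unitaryCompact} (C : U.AdelicTorusCore hP)
  (R12 : ∀ {L : CMField} {ι₁ : L →+* ℂ} (V : HermSpace3 L ι₁) (c : SeesawCtx L), C.Rest12 V c)
  (R34 : ∀ {L : CMField} {ι₁ : L →+* ℂ} (V : HermSpace3 L ι₁) (c : SeesawCtx L), C.Rest34 V c)
section Charts
variable {L : CMField} {ι₁ : L →+* ℂ} (V : HermSpace3 L ι₁) (c : SeesawCtx L) [DecidableEq (InfinitePlace (L : Type))]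
  (kind : InfinitePlace (L : Type) → PlaceKind) (lam : InfinitePlace (L : Type) → ℂ) (hlam : ∀ w, lam w ≠ 0)

/-- **The canonical (12) chart torus of the end state**: the printed places' torus with the PINNED vacuum characters of
the typed weight `((R12 V c).m₁, (R12 V c).m₂)`, mapped into the model group of `U(W)` by
`jT₁₂Model ∘ toAdeles ∘ (placesEquiv L)⁻¹ ∘ placesCoord` (pv11-g8 `printedTorusHom`). -/
abbrev chart12 : (printPlaces (InfinitePlace (L : Type)) kind lam hlam
      (pinnedVacs kind (R12 V c).m₁ (R12 V c).m₂)).Tg →* (c.D.latticeModelW hP).G :=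
  printedTorusHom kind lam hlam ((c.D.jT₁₂Model hP).toMonoidHom.comp (toAdeles (L : Type)))
    (pinnedVacs kind (R12 V c).m₁ (R12 V c).m₂)

/-- **The canonical (34) chart torus of the end state** (`jT₃₄Model`, typed weight of `R34 V c`). -/
abbrev chart34 : (printPlaces (InfinitePlace (L : Type)) kind lam hlam
      (pinnedVacs kind (R34 V c).m₁ (R34 V c).m₂)).Tg →* (c.D.latticeModelW hP).G :=
  printedTorusHom kind lam hlam ((c.D.jT₃₄Model hP).toMonoidHom.comp (toAdeles (L : Type)))
    (pinnedVacs kind (R34 V c).m₁ (R34 V c).m₂)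

variable (hA : (C.rtc R12 R34).Analytic)

/-- **N29's (12) torus half on the END STATE (KERNEL).**  For the end-state theta model
`T∘ := ThetaModel.ofRegCarrier (C.rtc R12 R34) hA`: a non-zero vector of `σ̂_i` on which the printed torus acts through
the canonical chart by the printed weight makes the typed weight `w` OCCUR in `σ_∞|_T` — the conclusion is literally the
S4 predicate `(T∘.t12 V c).wOccurs i` of the frozen Prior record (pv11-g8's `toTorusData_wOccurs_of_printedEigenvector`
with `e := id`; `Tι = SeesawArchTorus L`, `w = weight L m₁ m₂`, `torus = jT₁₂Model ∘ toAdeles` hold by `rfl` on prl1-g4's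
`CompactRest.rest`). -/
theorem t12_wOccurs_of_printedEigenvector (i : (ThetaModel.ofRegCarrier (C.rtc R12 R34) hA).SigIdx V c)
    (h : ∃ y ∈ ((ThetaModel.ofRegCarrier (C.rtc R12 R34) hA).core V c).hatσ i, y ≠ 0 ∧
      ∀ t : (printPlaces (InfinitePlace (L : Type)) kind lam hlam (pinnedVacs kind (R12 V c).m₁ (R12 V c).m₂)).Tg,
        ((ThetaModel.ofRegCarrier (C.rtc R12 R34) hA).core V c).R (C.chart12 R12 V c kind lam hlam t) y =
          printPlacesW (InfinitePlace (L : Type)) kind lam hlam (pinnedVacs kind (R12 V c).m₁ (R12 V c).m₂) t • y) :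
    ((ThetaModel.ofRegCarrier (C.rtc R12 R34) hA).t12 V c).wOccurs i :=
  RepTorusCarrier.toTorusData_wOccurs_of_printedEigenvector
    (((C.withRest R12 R34).toAdelicModelThetaData.kt12 V c).toRegTorusCarrier.toRepTorusCarrier)
    kind lam hlam (hA.toRepThetaCarrier.toThetaCarrier.core V c) (hA.toRepThetaCarrier.toThetaCarrier.t12 V c)
    id Function.surjective_id
    (R12 V c).m₁ (R12 V c).m₂ (fun _ => rfl) (C.chart12 R12 V c kind lam hlam) (fun _ => rfl) i h

/-- **N29's (34) torus half on the END STATE (KERNEL)** — `kt34`, `jT₃₄Model`, `R34`. -/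
theorem t34_wOccurs_of_printedEigenvector (i : (ThetaModel.ofRegCarrier (C.rtc R12 R34) hA).SigIdx V c)
    (h : ∃ y ∈ ((ThetaModel.ofRegCarrier (C.rtc R12 R34) hA).core V c).hatσ i, y ≠ 0 ∧
      ∀ t : (printPlaces (InfinitePlace (L : Type)) kind lam hlam (pinnedVacs kind (R34 V c).m₁ (R34 V c).m₂)).Tg,
        ((ThetaModel.ofRegCarrier (C.rtc R12 R34) hA).core V c).R (C.chart34 R34 V c kind lam hlam t) y =
          printPlacesW (InfinitePlace (L : Type)) kind lam hlam (pinnedVacs kind (R34 V c).m₁ (R34 V c).m₂) t • y) :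
    ((ThetaModel.ofRegCarrier (C.rtc R12 R34) hA).t34 V c).wOccurs i :=
  RepTorusCarrier.toTorusData_wOccurs_of_printedEigenvector
    (((C.withRest R12 R34).toAdelicModelThetaData.kt34 V c).toRegTorusCarrier.toRepTorusCarrier)
    kind lam hlam (hA.toRepThetaCarrier.toThetaCarrier.core V c) (hA.toRepThetaCarrier.toThetaCarrier.t34 V c)
    id Function.surjective_id
    (R34 V c).m₁ (R34 V c).m₂ (fun _ => rfl) (C.chart34 R34 V c kind lam hlam) (fun _ => rfl) i h

end Charts

/-! ## §3  `Open_occ` of the end-state theta model from torus-free, N21-free printed analytic data -/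

section OpenOcc

variable (hA : (C.rtc R12 R34).Analytic)

/-- **The (12) printed analytic core of a context on the END STATE** — everything the input `occ` still asks of the
pair (12) once the torus half, N21, the continuity `cont` and the evaluation points are theorems / canonical: a kind map
and non-zero scalings for the places, and a MODEL analytic side (twenty fields) over `T∘.core V c` at the canonical
points `C.pointedCore` (node #2) and the canonical chart `chart12` with the pinned vacuum characters of the typed weight
of `R12 V c`.  No field mentions the torus datum, the point datum, N21 or `cont`. -/
structure PrintedCore12 {L : CMField} {ι₁ : L →+* ℂ} (V : HermSpace3 L ι₁) (c : SeesawCtx L) where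
  /-- decidable equality of the infinite places (any instance; used only to form the printed places) -/
  [decEq : DecidableEq (InfinitePlace (L : Type))]
  /-- the kind `Σ₁₂ / D₁₂ / ι₁` of each infinite place -/
  kind : InfinitePlace (L : Type) → PlaceKind
  /-- the printed scalings `λ_b ≠ 0` -/
  lam : InfinitePlace (L : Type) → ℂ
  hlam : ∀ w, lam w ≠ 0
  /-- the model analytic side at the canonical points and the canonical (12) chart -/
  side : ModelAnalyticSide ((ThetaModel.ofRegCarrier (C.rtc R12 R34) hA).core V c) (C.pointedCore R12 R34 hA V c)
    (InfinitePlace (L : Type)) kind lam hlam (pinnedVacs kind (R12 V c).m₁ (R12 V c).m₂)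
    (C.chart12 R12 V c kind lam hlam)

/-- **The (34) printed analytic core of a context on the END STATE** (`chart34`, typed weight of `R34 V c`). -/
structure PrintedCore34 {L : CMField} {ι₁ : L →+* ℂ} (V : HermSpace3 L ι₁) (c : SeesawCtx L) where
  [decEq : DecidableEq (InfinitePlace (L : Type))]
  kind : InfinitePlace (L : Type) → PlaceKind
  lam : InfinitePlace (L : Type) → ℂ
  hlam : ∀ w, lam w ≠ 0
  side : ModelAnalyticSide ((ThetaModel.ofRegCarrier (C.rtc R12 R34) hA).core V c) (C.pointedCore R12 R34 hA V c)
    (InfinitePlace (L : Type)) kind lam hlam (pinnedVacs kind (R34 V c).m₁ (R34 V c).m₂)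
    (C.chart34 R34 V c kind lam hlam)

namespace PrintedCore12

variable {C R12 R34 hA} {L : CMField} {ι₁ : L →+* ℂ} {V : HermSpace3 L ι₁} {c : SeesawCtx L}

/-- The torus-free side of pv12-g7's record on the end state: `cont` and `invariance` (N21) are node #2's theorems
`continuous_evalPt_TΦc`, `invariance` (`EndStateInvariance`). -/
def toTorusFree (A : PrintedCore12 C R12 R34 hA V c) :
    letI := A.decEq
    TorusFreeAnalyticSide ((ThetaModel.ofRegCarrier (C.rtc R12 R34) hA).core V c) (C.pointedCore R12 R34 hA V c)
      (InfinitePlace (L : Type)) A.kind A.lam A.hlam (pinnedVacs A.kind (R12 V c).m₁ (R12 V c).m₂)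
      (C.chart12 R12 V c A.kind A.lam A.hlam) :=
  letI := A.decEq
  A.side.toTorusFree (C.continuous_evalPt_TΦc R12 R34 hA V c) (C.invariance R12 R34 hA V c)

/-- The full S4 record of pv12-g7 on the end state, from the (12) printed core: `P :=` the canonical points,
`cont`, `invariance` := node #2's theorems, last field := §2's theorem. -/
def toSide (A : PrintedCore12 C R12 R34 hA V c) :
    letI := A.decEq
    PrintedAnalyticSide ((ThetaModel.ofRegCarrier (C.rtc R12 R34) hA).core V c)
      ((ThetaModel.ofRegCarrier (C.rtc R12 R34) hA).t12 V c) (C.pointedCore R12 R34 hA V c) (InfinitePlace (L : Type))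
      A.kind A.lam A.hlam (pinnedVacs A.kind (R12 V c).m₁ (R12 V c).m₂) :=
  letI := A.decEq
  A.toTorusFree.toSide _ (C.t12_wOccurs_of_printedEigenvector R12 R34 V c A.kind A.lam A.hlam hA)

/-- **Lemma 4.1(c), pair (12), on the END STATE from the printed core alone.** -/
theorem H_occ (A : PrintedCore12 C R12 R34 hA V c) :
    ∀ (Φ : (ThetaModel.ofRegCarrier (C.rtc R12 R34) hA).SK V c)
      (i : (ThetaModel.ofRegCarrier (C.rtc R12 R34) hA).SigIdx V c),
      (∃ v ∈ ((ThetaModel.ofRegCarrier (C.rtc R12 R34) hA).core V c).hatσ i,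
        ((ThetaModel.ofRegCarrier (C.rtc R12 R34) hA).core V c).TΦ Φ v ≠ 0) →
      ((ThetaModel.ofRegCarrier (C.rtc R12 R34) hA).t12 V c).wOccurs i :=
  letI := A.decEq
  A.toSide.H_occ

end PrintedCore12

namespace PrintedCore34

variable {C R12 R34 hA} {L : CMField} {ι₁ : L →+* ℂ} {V : HermSpace3 L ι₁} {c : SeesawCtx L}

/-- The torus-free side of pv12-g7's record on the end state, pair (34). -/
def toTorusFree (A : PrintedCore34 C R12 R34 hA V c) :
    letI := A.decEq
    TorusFreeAnalyticSide ((ThetaModel.ofRegCarrier (C.rtc R12 R34) hA).core V c) (C.pointedCore R12 R34 hA V c)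
      (InfinitePlace (L : Type)) A.kind A.lam A.hlam (pinnedVacs A.kind (R34 V c).m₁ (R34 V c).m₂)
      (C.chart34 R34 V c A.kind A.lam A.hlam) :=
  letI := A.decEq
  A.side.toTorusFree (C.continuous_evalPt_TΦc R12 R34 hA V c) (C.invariance R12 R34 hA V c)

/-- The full S4 record of pv12-g7 on the end state, from the (34) printed core. -/
def toSide (A : PrintedCore34 C R12 R34 hA V c) :
    letI := A.decEq
    PrintedAnalyticSide ((ThetaModel.ofRegCarrier (C.rtc R12 R34) hA).core V c)
      ((ThetaModel.ofRegCarrier (C.rtc R12 R34) hA).t34 V c) (C.pointedCore R12 R34 hA V c) (InfinitePlace (L : Type))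
      A.kind A.lam A.hlam (pinnedVacs A.kind (R34 V c).m₁ (R34 V c).m₂) :=
  letI := A.decEq
  A.toTorusFree.toSide _ (C.t34_wOccurs_of_printedEigenvector R12 R34 V c A.kind A.lam A.hlam hA)

/-- **Lemma 4.1(c), pair (34), on the END STATE from the printed core alone.** -/
theorem H_occ (A : PrintedCore34 C R12 R34 hA V c) :
    ∀ (Φ : (ThetaModel.ofRegCarrier (C.rtc R12 R34) hA).SK V c)
      (i : (ThetaModel.ofRegCarrier (C.rtc R12 R34) hA).SigIdx V c),
      (∃ v ∈ ((ThetaModel.ofRegCarrier (C.rtc R12 R34) hA).core V c).hatσ i,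
        ((ThetaModel.ofRegCarrier (C.rtc R12 R34) hA).core V c).TΦ Φ v ≠ 0) →
      ((ThetaModel.ofRegCarrier (C.rtc R12 R34) hA).t34 V c).wOccurs i :=
  letI := A.decEq
  A.toSide.H_occ

end PrintedCore34

/-- **`Open_occ` (N29 = PerL Lemma 4.1(c) / Thm 3.7 (†), BOTH torus sides) of the END-STATE theta model from torus-free,
N21-free printed analytic data**: per good context one `PrintedCore12` and one `PrintedCore34`.  No torus-side
hypothesis, no point datum, no N21 / continuity hypothesis. -/
theorem Open_occ_of_printedCores
    (A12 : ∀ {L : CMField} {ι₁ : L →+* ℂ} (V : HermSpace3 L ι₁) (c : SeesawCtx L),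
      (ThetaModel.ofRegCarrier (C.rtc R12 R34) hA).GoodCtx ι₁ c → Nonempty (C.PrintedCore12 R12 R34 hA V c))
    (A34 : ∀ {L : CMField} {ι₁ : L →+* ℂ} (V : HermSpace3 L ι₁) (c : SeesawCtx L),
      (ThetaModel.ofRegCarrier (C.rtc R12 R34) hA).GoodCtx ι₁ c → Nonempty (C.PrintedCore34 R12 R34 hA V c)) :
    (ThetaModel.ofRegCarrier (C.rtc R12 R34) hA).Open_occ :=
  fun V c hc => ⟨fun Φ i h => (A12 V c hc).elim fun A => A.H_occ Φ i h,
    fun Φ i h => (A34 V c hc).elim fun A => A.H_occ Φ i h⟩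

/-- **N29 BY THE CARVER'S NAME** (`Arch.N29_occ`) on the end state, from the printed cores. -/
theorem N29_occ_of_printedCores
    (A12 : ∀ {L : CMField} {ι₁ : L →+* ℂ} (V : HermSpace3 L ι₁) (c : SeesawCtx L),
      (ThetaModel.ofRegCarrier (C.rtc R12 R34) hA).GoodCtx ι₁ c → Nonempty (C.PrintedCore12 R12 R34 hA V c))
    (A34 : ∀ {L : CMField} {ι₁ : L →+* ℂ} (V : HermSpace3 L ι₁) (c : SeesawCtx L),
      (ThetaModel.ofRegCarrier (C.rtc R12 R34) hA).GoodCtx ι₁ c → Nonempty (C.PrintedCore34 R12 R34 hA V c)) :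
    N29_occ (ThetaModel.ofRegCarrier (C.rtc R12 R34) hA) :=
  C.Open_occ_of_printedCores R12 R34 hA A12 A34

end OpenOcc

end AdelicTorusCore

/-! ## §4  The same for the sign-recipe end state `C₀.thetaModel h d12 d34` (prl1-g5) -/

namespace AdelicThetaCore

open HodgeCM.PerL34

variable {U : Universe} {hP : PrintFact_unitaryCompact} (C₀ : U.AdelicThetaCore hP) (h : Bool)
  (d12 d34 : ∀ {L : CMField}, SeesawCtx L → SideData L)

/-- **`Open_occ` of prl1-g5's END-STATE model `C₀.thetaModel h d12 d34`** (the model of `Assembly.perL_ofSignRecipe₀` for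
`hP := printFact_unitaryCompact_holds`) from the printed cores of its contexts — `Open_occ_of_printedCores` at
`C := C₀.toCore h`, `R12 := side12 d12`, `R34 := side34 d34`, `hA := (analyticKM …).toAnalytic`, by `rfl`. -/
theorem Open_occ_thetaModel_of_printedCores
    (A12 : ∀ {L : CMField} {ι₁ : L →+* ℂ} (V : HermSpace3 L ι₁) (c : SeesawCtx L),
      (C₀.thetaModel h d12 d34).GoodCtx ι₁ c →
        Nonempty ((C₀.toCore h).PrintedCore12 ((C₀.toCore h).side12 d12) ((C₀.toCore h).side34 d34)
          ((C₀.toCore h).analyticKM ((C₀.toCore h).side12 d12) ((C₀.toCore h).side34 d34)).toAnalytic V c))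
    (A34 : ∀ {L : CMField} {ι₁ : L →+* ℂ} (V : HermSpace3 L ι₁) (c : SeesawCtx L),
      (C₀.thetaModel h d12 d34).GoodCtx ι₁ c →
        Nonempty ((C₀.toCore h).PrintedCore34 ((C₀.toCore h).side12 d12) ((C₀.toCore h).side34 d34)
          ((C₀.toCore h).analyticKM ((C₀.toCore h).side12 d12) ((C₀.toCore h).side34 d34)).toAnalytic V c)) :
    (C₀.thetaModel h d12 d34).Open_occ :=
  (C₀.toCore h).Open_occ_of_printedCores _ _ _ A12 A34

/-- … and by the carver's name `N29_occ`. -/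
theorem N29_occ_thetaModel_of_printedCores
    (A12 : ∀ {L : CMField} {ι₁ : L →+* ℂ} (V : HermSpace3 L ι₁) (c : SeesawCtx L),
      (C₀.thetaModel h d12 d34).GoodCtx ι₁ c →
        Nonempty ((C₀.toCore h).PrintedCore12 ((C₀.toCore h).side12 d12) ((C₀.toCore h).side34 d34)
          ((C₀.toCore h).analyticKM ((C₀.toCore h).side12 d12) ((C₀.toCore h).side34 d34)).toAnalytic V c))
    (A34 : ∀ {L : CMField} {ι₁ : L →+* ℂ} (V : HermSpace3 L ι₁) (c : SeesawCtx L),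
      (C₀.thetaModel h d12 d34).GoodCtx ι₁ c →
        Nonempty ((C₀.toCore h).PrintedCore34 ((C₀.toCore h).side12 d12) ((C₀.toCore h).side34 d34)
          ((C₀.toCore h).analyticKM ((C₀.toCore h).side12 d12) ((C₀.toCore h).side34 d34)).toAnalytic V c)) :
    N29_occ (C₀.thetaModel h d12 d34) :=
  C₀.Open_occ_thetaModel_of_printedCores h d12 d34 A12 A34

end AdelicThetaCore

end Universe

/-! ## §5  The binder-minimal END STATES with N29's torus half discharged -/

namespace Assembly

open HodgeCM.PerL34
open HodgeCM.Prior.Perl34File HodgeCM.Prior.Perl34File.Perl34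
open HodgeCM.Universe (AdelicThetaCore AdelicThetaCore₀ AdelicTorusCore SideData ThetaModel)

variable (U : Universe)

/-- **Both realisation inputs of part (a), binder-minimal END STATE, `occ` from printed cores**: prl1-g5's
`realisationExists_ofSignRecipe₀` with the input `occ` (N29) REPLACED by the torus-free printed analytic cores of the
good contexts (`PrintedCore12` / `PrintedCore34`); the other seven non-design inputs by name (2 PRINT: `embCover` N09a,
`innerEmb` N09b; 5 OPEN: `thetaSub` N12, `thetaWedge` N33, `thetaGen12` N19w, `thetaReal34` N19g, `chars` N31). -/
theorem realisationExists_ofSignRecipe₀_printedCores (M : U.ModelAxioms) (h : Bool) (C : U.AdelicThetaCore₀)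
    (d12 d34 : ∀ {L : CMField}, SeesawCtx L → SideData L)
    (embCover : (C.thetaModel h d12 d34).Fact_embCover) (innerEmb : (C.thetaModel h d12 d34).Fact_innerEmb)
    (thetaSub : (C.thetaModel h d12 d34).Open_thetaSub) (thetaWedge : (C.thetaModel h d12 d34).Open_thetaWedge)
    (thetaGen12 : (C.thetaModel h d12 d34).Open_thetaGen12)
    (thetaReal34 : (C.thetaModel h d12 d34).Open_thetaReal34) (chars : (C.thetaModel h d12 d34).Open_chars)
    (A12 : ∀ {L : CMField} {ι₁ : L →+* ℂ} (V : HermSpace3 L ι₁) (c : SeesawCtx L),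
      (C.thetaModel h d12 d34).GoodCtx ι₁ c →
        Nonempty ((C.toCore h).PrintedCore12 ((C.toCore h).side12 d12) ((C.toCore h).side34 d34)
          ((C.toCore h).analyticKM ((C.toCore h).side12 d12) ((C.toCore h).side34 d34)).toAnalytic V c))
    (A34 : ∀ {L : CMField} {ι₁ : L →+* ℂ} (V : HermSpace3 L ι₁) (c : SeesawCtx L),
      (C.thetaModel h d12 d34).GoodCtx ι₁ c →
        Nonempty ((C.toCore h).PrintedCore34 ((C.toCore h).side12 d12) ((C.toCore h).side34 d34)
          ((C.toCore h).analyticKM ((C.toCore h).side12 d12) ((C.toCore h).side34 d34)).toAnalytic V c))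
    (hHR : U.Fact_hodgeRiemann20) : U.RealisationExistsPerL ∧ U.RealisationExistsFace :=
  realisationExists_ofSignRecipe₀ U M h C d12 d34
    ⟨embCover, innerEmb, thetaSub, thetaWedge, thetaGen12, thetaReal34, chars,
      C.Open_occ_thetaModel_of_printedCores h d12 d34 A12 A34⟩ hHR

/-- **PerL, binder-minimal END STATE, `occ` from printed cores.**  Binders: `M`; `h`; the core DATA `C`; the torus-side
DATA `d12`, `d34`; seven named theta inputs (2 PRINT + 5 OPEN); per good context the printed analytic cores `A12`,
`A34` (torus-free); Hodge–Riemann. -/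
theorem perL_ofSignRecipe₀_printedCores (M : U.ModelAxioms) (h : Bool) (C : U.AdelicThetaCore₀)
    (d12 d34 : ∀ {L : CMField}, SeesawCtx L → SideData L)
    (embCover : (C.thetaModel h d12 d34).Fact_embCover) (innerEmb : (C.thetaModel h d12 d34).Fact_innerEmb)
    (thetaSub : (C.thetaModel h d12 d34).Open_thetaSub) (thetaWedge : (C.thetaModel h d12 d34).Open_thetaWedge)
    (thetaGen12 : (C.thetaModel h d12 d34).Open_thetaGen12)
    (thetaReal34 : (C.thetaModel h d12 d34).Open_thetaReal34) (chars : (C.thetaModel h d12 d34).Open_chars)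
    (A12 : ∀ {L : CMField} {ι₁ : L →+* ℂ} (V : HermSpace3 L ι₁) (c : SeesawCtx L),
      (C.thetaModel h d12 d34).GoodCtx ι₁ c →
        Nonempty ((C.toCore h).PrintedCore12 ((C.toCore h).side12 d12) ((C.toCore h).side34 d34)
          ((C.toCore h).analyticKM ((C.toCore h).side12 d12) ((C.toCore h).side34 d34)).toAnalytic V c))
    (A34 : ∀ {L : CMField} {ι₁ : L →+* ℂ} (V : HermSpace3 L ι₁) (c : SeesawCtx L),
      (C.thetaModel h d12 d34).GoodCtx ι₁ c →
        Nonempty ((C.toCore h).PrintedCore34 ((C.toCore h).side12 d12) ((C.toCore h).side34 d34)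
          ((C.toCore h).analyticKM ((C.toCore h).side12 d12) ((C.toCore h).side34 d34)).toAnalytic V c))
    (hHR : U.Fact_hodgeRiemann20) : U.PerL :=
  perL_ofSignRecipe₀ U M h C d12 d34
    ⟨embCover, innerEmb, thetaSub, thetaWedge, thetaGen12, thetaReal34, chars,
      C.Open_occ_thetaModel_of_printedCores h d12 d34 A12 A34⟩ hHR

/-- **COR-CM, binder-minimal END STATE, `occ` from printed cores.** -/
theorem COR_CM_endState_ofSignRecipe₀_printedCores (M : U.ModelAxioms) (h29 : U.Fact_weightSpan)
    (h30 : U.Fact_weightHodge) (hE : U.Qw8ExtProd) (hD : U.Qw8DualPushPull) (hMi : U.Qw8Milne) (h : Bool)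
    (C : U.AdelicThetaCore₀) (d12 d34 : ∀ {L : CMField}, SeesawCtx L → SideData L)
    (embCover : (C.thetaModel h d12 d34).Fact_embCover) (innerEmb : (C.thetaModel h d12 d34).Fact_innerEmb)
    (thetaSub : (C.thetaModel h d12 d34).Open_thetaSub) (thetaWedge : (C.thetaModel h d12 d34).Open_thetaWedge)
    (thetaGen12 : (C.thetaModel h d12 d34).Open_thetaGen12)
    (thetaReal34 : (C.thetaModel h d12 d34).Open_thetaReal34) (chars : (C.thetaModel h d12 d34).Open_chars)
    (A12 : ∀ {L : CMField} {ι₁ : L →+* ℂ} (V : HermSpace3 L ι₁) (c : SeesawCtx L),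
      (C.thetaModel h d12 d34).GoodCtx ι₁ c →
        Nonempty ((C.toCore h).PrintedCore12 ((C.toCore h).side12 d12) ((C.toCore h).side34 d34)
          ((C.toCore h).analyticKM ((C.toCore h).side12 d12) ((C.toCore h).side34 d34)).toAnalytic V c))
    (A34 : ∀ {L : CMField} {ι₁ : L →+* ℂ} (V : HermSpace3 L ι₁) (c : SeesawCtx L),
      (C.thetaModel h d12 d34).GoodCtx ι₁ c →
        Nonempty ((C.toCore h).PrintedCore34 ((C.toCore h).side12 d12) ((C.toCore h).side34 d34)
          ((C.toCore h).analyticKM ((C.toCore h).side12 d12) ((C.toCore h).side34 d34)).toAnalytic V c))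
    (hHR : U.Fact_hodgeRiemann20) : U.HC_CM :=
  COR_CM_endState_ofSignRecipe₀ U M h29 h30 hE hD hMi h C d12 d34
    ⟨embCover, innerEmb, thetaSub, thetaWedge, thetaGen12, thetaReal34, chars,
      C.Open_occ_thetaModel_of_printedCores h d12 d34 A12 A34⟩ hHR

end Assembly

end HodgeCM

end
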